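import Summits.CriticalPhenomena.PercolationContinuityZ3.Theorems.PercNearOneGluingNoHeavyQuantFarBundlePocket
import HarnessLib

/-!
# QUANT lane R8, front "FAR beyond trees", layer one — PENDANT BLOCKS I: reachability around a pendant vertex set hanging at a cut vertex

builds on p205010 (kernel theorem, internal audit signed; external expert review pending)

Support file (`--supports stmt-CriticalPhenomena-4575`), seat `prim-quant-p1` (gen 19); memo
`run/shared/lean/prim/quant/prim-quant-p1-g19/FOR-LEAD-CACTI.md` §1 (kernel plan §5, file K1).  Generalises the pocket
bookkeeping of `…QuantFarBundlePocket` (a bundle vertex with pendant leaves) to an ARBITRARY pendant vertex set.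
Pure combinatorics of open paths (no measure); standard axioms; no sorries.

**Setting.**  Vertices `Fin n`; a configuration `ω : BondConfig (Fin n)`; observer `o`; a BLOCK `Z` (any finite vertex set) hanging at
a cut vertex `c ∉ Z`, `o ∉ Z` (`o = c` allowed).  The configuration is GOOD (`Block.Good c Z ω`) if every open pair joining a vertex
of `Z` to a vertex outside `Z` ends at `c` — almost surely the case when all pairs between `Z` and `(Z ∪ {c})ᶜ` carry weight `0`
(file K2).

* `Block.onZ Z ω` — the open pairs MEETING `Z` (complementing `Bundle.offZ Z ω`, the open pairs avoiding `Z`);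
* **`Block.reach_off_iff`**: for `b ∉ Z`, `o ↔ b` in `ω` iff `o ↔ b` off `Z`;
* **`Block.reach_in_iff`**: for `a ∈ Z`, `o ↔ a` iff (`o ↔ c` off `Z`) and (`c ↔ a` through the pairs meeting `Z`);
* `Block.card_filter_eq` — hence `#{a ∈ A : o ↔ a} = #{a ∈ A ∖ Z : o ↔ a off Z} + 𝟙[o ↔ c off Z] · #{a ∈ A ∩ Z : c ↔ a on Z}`
  (the decomposition `N = N_rest + J · X` of the memo, §1).
[cite: Grimmett1999, §1.3 p. 10] (open paths / clusters); the bookkeeping is [this work].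
-/

namespace Summit.CriticalPhenomena.PercolationContinuityZ3.Theorems

namespace Quant

namespace Block

open Finset
open Literature.Probability.Percolation
open Bundle (offZ offZ_subset reachable_of_offZ)
open scoped Classical

variable {n : ℕ}

/-! ## Pairs meeting the block; good configurations -/

/-- The open pairs meeting the block `Z`. [this work] -/
def onZ (Z : Finset (Fin n)) (ω : BondConfig (Fin n)) : BondConfig (Fin n) := {e | e ∈ ω ∧ ∃ z ∈ Z, z ∈ e}

/-- `onZ Z ω ⊆ ω`. [this work] -/
theorem onZ_subset (Z : Finset (Fin n)) (ω : BondConfig (Fin n)) : onZ Z ω ⊆ ω := fun _ he => he.1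

/-- Paths through the pairs meeting `Z` are paths. [this work] -/
theorem reachable_of_onZ {Z : Finset (Fin n)} {ω : BondConfig (Fin n)} {x y : Fin n}
    (h : (openGraph (onZ Z ω)).Reachable x y) : (openGraph ω).Reachable x y :=
  h.mono (SimpleGraph.fromEdgeSet_mono (onZ_subset Z ω))

/-- A configuration is GOOD for the block `Z` hanging at `c` if every open pair from a vertex of `Z` to a vertex outside `Z`
ends at `c`. [this work] -/
def Good (c : Fin n) (Z : Finset (Fin n)) (ω : BondConfig (Fin n)) : Prop :=
  ∀ x y : Fin n, x ≠ y → s(x, y) ∈ ω → x ∈ Z → y ∉ Z → y = c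

/-- An open pair with both ends off `Z` is an edge of the off-`Z` graph. [this work] -/
theorem off_adj {Z : Finset (Fin n)} {ω : BondConfig (Fin n)} {x y : Fin n} (he : s(x, y) ∈ ω) (hxy : x ≠ y)
    (hx : x ∉ Z) (hy : y ∉ Z) : (openGraph (offZ Z ω)).Adj x y := by
  rw [openGraph_adj]
  refine ⟨⟨he, fun z hz hze => ?_⟩, hxy⟩
  rcases Sym2.mem_iff.1 hze with rfl | rfl
  · exact hx hz
  · exact hy hz

/-- An open pair with an end in `Z` is an edge of the on-`Z` graph. [this work] -/
theorem on_adj {Z : Finset (Fin n)} {ω : BondConfig (Fin n)} {x y : Fin n} (he : s(x, y) ∈ ω) (hxy : x ≠ y)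
    (h : x ∈ Z ∨ y ∈ Z) : (openGraph (onZ Z ω)).Adj x y := by
  rw [openGraph_adj]
  refine ⟨⟨he, ?_⟩, hxy⟩
  rcases h with h | h
  · exact ⟨x, h, Sym2.mem_mk_left x y⟩
  · exact ⟨y, h, Sym2.mem_mk_right x y⟩

section Reach

variable {o c : Fin n} {Z : Finset (Fin n)}

/-- Walk invariant I: along an open walk of a good configuration ending OFF the block, a start off the block is joined to the end
off `Z`, and from a start in the block the cut vertex is joined to the end off `Z`. [this work] -/
theorem inv_off_of_walk {ω : BondConfig (Fin n)} (hω : Good c Z ω) {b : Fin n} (hb : b ∉ Z) :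
    ∀ (v : Fin n) (_ : (openGraph ω).Walk v b),
      (v ∉ Z → (openGraph (offZ Z ω)).Reachable v b) ∧ (v ∈ Z → (openGraph (offZ Z ω)).Reachable c b) := by
  intro v q
  induction q with
  | nil => exact ⟨fun _ => SimpleGraph.Reachable.refl _, fun h => absurd h hb⟩
  | cons hadj q' ih =>
    rename_i v' x b'
    obtain ⟨h1, h2⟩ := ih hb
    rw [openGraph_adj] at hadj
    obtain ⟨he, hne⟩ := hadj
    constructor
    · intro hv
      by_cases hxZ : x ∈ Z
      · -- the pair leaves `Z` at `v'`, so `v' = c`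
        have hvc : v' = c := hω x v' (Ne.symm hne) (by rw [Sym2.eq_swap]; exact he) hxZ hv
        rw [hvc]; exact h2 hxZ
      · exact (off_adj he hne hv hxZ).reachable.trans (h1 hxZ)
    · intro hv
      by_cases hxZ : x ∈ Z
      · exact h2 hxZ
      · have hxc : x = c := hω v' x hne he hv hxZ
        rw [← hxc]; exact h1 hxZ

/-- **Vertices off the block are reached off the block.**  For `b ∉ Z` (and `o ∉ Z`): `o ↔ b` in `ω` iff `o ↔ b` in `offZ Z ω`.
[this work] -/
theorem reach_off_iff {ω : BondConfig (Fin n)} (hω : Good c Z ω) (ho : o ∉ Z) {b : Fin n} (hb : b ∉ Z) :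
    (openGraph ω).Reachable o b ↔ (openGraph (offZ Z ω)).Reachable o b := by
  refine ⟨fun h => ?_, reachable_of_offZ⟩
  obtain ⟨q⟩ := h
  exact (inv_off_of_walk hω hb o q).1 ho

/-- Walk invariant II: along an open walk of a good configuration ending IN the block at `a`, a start off the block is joined to
`c` off `Z` while `c` is joined to `a` on `Z`, and a start in the block is joined to `a` on `Z`. [this work] -/
theorem inv_in_of_walk {ω : BondConfig (Fin n)} (hω : Good c Z ω) (hc : c ∉ Z) {a : Fin n} (ha : a ∈ Z) :
    ∀ (v : Fin n) (_ : (openGraph ω).Walk v a),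
      (v ∉ Z → (openGraph (offZ Z ω)).Reachable v c ∧ (openGraph (onZ Z ω)).Reachable c a) ∧
      (v ∈ Z → (openGraph (onZ Z ω)).Reachable v a) := by
  intro v q
  induction q with
  | nil => exact ⟨fun h => absurd ha h, fun _ => SimpleGraph.Reachable.refl _⟩
  | cons hadj q' ih =>
    rename_i v' x a'
    obtain ⟨h1, h2⟩ := ih ha
    rw [openGraph_adj] at hadj
    obtain ⟨he, hne⟩ := hadj
    constructor
    · intro hv
      by_cases hxZ : x ∈ Z
      · -- the pair enters `Z` from `v'`, so `v' = c`
        have hvc : v' = c := hω x v' (Ne.symm hne) (by rw [Sym2.eq_swap]; exact he) hxZ hv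
        subst hvc
        exact ⟨SimpleGraph.Reachable.refl _, (on_adj he hne (Or.inr hxZ)).reachable.trans (h2 hxZ)⟩
      · obtain ⟨hR, hin⟩ := h1 hxZ
        exact ⟨(off_adj he hne hv hxZ).reachable.trans hR, hin⟩
    · intro hv
      by_cases hxZ : x ∈ Z
      · exact (on_adj he hne (Or.inl hv)).reachable.trans (h2 hxZ)
      · have hxc : x = c := hω v' x hne he hv hxZ
        obtain ⟨-, hin⟩ := h1 hxZ
        have hadj' : (openGraph (onZ Z ω)).Adj v' x := on_adj he hne (Or.inl hv)
        rw [hxc] at hadj'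
        exact hadj'.reachable.trans hin

/-- **Vertices of the block are reached through the cut vertex.**  For `a ∈ Z` (`o, c ∉ Z`): `o ↔ a` in `ω` iff `o ↔ c` off `Z`
and `c ↔ a` on `Z`. [this work] -/
theorem reach_in_iff {ω : BondConfig (Fin n)} (hω : Good c Z ω) (ho : o ∉ Z) (hc : c ∉ Z) {a : Fin n} (ha : a ∈ Z) :
    (openGraph ω).Reachable o a ↔
      (openGraph (offZ Z ω)).Reachable o c ∧ (openGraph (onZ Z ω)).Reachable c a := by
  refine ⟨fun h => ?_, fun ⟨h₁, h₂⟩ => (reachable_of_offZ h₁).trans (reachable_of_onZ h₂)⟩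
  obtain ⟨q⟩ := h
  exact (inv_in_of_walk hω hc ha o q).1 ho

/-- **The count decomposition `N = N_rest + J · X`** (memo §1).  For a good configuration and any relay set `A`:
`#{a ∈ A : o ↔ a} = #{a ∈ A ∖ Z : o ↔ a off Z} + (if o ↔ c off Z then #{a ∈ A ∩ Z : c ↔ a on Z} else 0)`. [this work] -/
theorem card_filter_eq {ω : BondConfig (Fin n)} (hω : Good c Z ω) (ho : o ∉ Z) (hc : c ∉ Z) (A : Finset (Fin n)) :
    (A.filter fun a => ω ∈ openConn o a).card =
      ((A \ Z).filter fun a => offZ Z ω ∈ openConn o a).card +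
        (if offZ Z ω ∈ openConn o c then ((A ∩ Z).filter fun a => onZ Z ω ∈ openConn c a).card else 0) := by
  have hsplit : (A.filter fun a => ω ∈ openConn o a) =
      ((A \ Z).filter fun a => ω ∈ openConn o a) ∪ ((A ∩ Z).filter fun a => ω ∈ openConn o a) := by
    rw [← filter_union, sdiff_union_inter]
  have hdisj : Disjoint ((A \ Z).filter fun a => ω ∈ openConn o a) ((A ∩ Z).filter fun a => ω ∈ openConn o a) :=
    disjoint_filter_filter (disjoint_sdiff_inter A Z)
  rw [hsplit, card_union_of_disjoint hdisj]
  congr 1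
  · refine congrArg _ (filter_congr fun a ha => ?_)
    exact reach_off_iff hω ho (mem_sdiff.1 ha).2
  · by_cases hR : offZ Z ω ∈ openConn o c
    · rw [if_pos hR]
      refine congrArg _ (filter_congr fun a ha => ?_)
      rw [show (ω ∈ openConn o a) = (openGraph ω).Reachable o a from rfl, reach_in_iff hω ho hc (mem_inter.1 ha).2]
      exact ⟨fun h => h.2, fun h => ⟨hR, h⟩⟩
    · rw [if_neg hR, card_eq_zero, filter_eq_empty_iff]
      intro a ha h
      exact hR ((reach_in_iff hω ho hc (mem_inter.1 ha).2).1 h).1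

end Reach

end Block

end Quant

end Summit.CriticalPhenomena.PercolationContinuityZ3.Theorems
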